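import Mathlib.RingTheory.SimpleModule.Isotypic
import Mathlib.RepresentationTheory.Intertwining
import Literature.RepresentationTheory.IrreducibleTwistTransport
import HarnessLib

/-!
# Isotypy is transported along pull-back by a group homomorphism (surjections, isomorphisms)

Topic `RepresentationTheory`; namespace `Literature.RepresentationTheory`.  Theorems only (no definition, no named fact, no `sorry`).

For representations `ρ'` of `G'` on `W` and `τ'` of `G'` on `T` over a field `k` and a homomorphism `f : G →* G'`, write
`ρ' ∘ f`, `τ' ∘ f` for the pulled-back representations of `G` (Mathlib `MonoidHom.comp`).  The `k[G']`-module of `ρ'` is the sum of its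
submodules isomorphic to `τ'` (Mathlib `isotypicComponent k[G'] ρ'.asModule τ'.asModule = ⊤`, i.e. `ρ'` is `τ'`-ISOTYPIC) —

* `isotypicComponent_comp_eq_top_of_isIrreducible` — … then `ρ' ∘ f` is `τ' ∘ f`-isotypic, for ANY `f`, as soon as `τ' ∘ f` is irreducible
  (every `G'`-intertwiner `τ' → ρ'` is a `G`-intertwiner `τ' ∘ f → ρ' ∘ f`; a copy of `τ'` in `W` is the image of such an intertwiner, hence lies
  in the `τ' ∘ f`-isotypic component; Mathlib `Submodule.map_le_isotypicComponent`, `Submodule.iSup_induction`);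
* `isotypicComponent_eq_top_of_comp_eq_top` — conversely, for `f` SURJECTIVE, `τ' ∘ f`-isotypy of `ρ' ∘ f` gives `τ'`-isotypy of `ρ'`
  (a `G`-intertwiner of the pull-backs is a `G'`-intertwiner);
* `isotypicComponent_comp_eq_top_iff_of_surjective` — the equivalence for `f` surjective and `τ'` irreducible (irreducibility of `τ' ∘ f` is
  then automatic: ★ `Representation.isIrreducible_comp_iff_of_surjective`);
* `isotypicComponent_comp_mulEquiv_eq_top_iff` — the case of a group isomorphism `e : G ≃* G'`.

This is the bookkeeping behind «local types are transported along an isomorphism of local groups» (conjugate hermitian forms have conjugate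
unitary groups: the local type of a representation of `U(J)(F_v)` read on `U(J')(F_v)` along `u ↦ B u B⁻¹`) — Bump 1997, §3.4 (the isotypic
type is an isomorphism class; Prop. 3.4.1), Flath 1979 §2; Platonov–Rapinchuk 1994 §2.3 for the transport of unitary groups.

## References
* [Bump1997] D. Bump, *Automorphic Forms and Representations*, Cambridge Stud. Adv. Math. 55 (1997), §3.4, Prop. 3.4.1.
* [Flath1979] D. Flath, Decomposition of representations into tensor products, PSPM 33.1 (1979), §2.
* [PlatonovRapinchuk1994] V. Platonov, A. Rapinchuk, *Algebraic Groups and Number Theory* (1994), §2.3.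
-/

set_option autoImplicit false

namespace Literature.RepresentationTheory

open Representation

variable {k : Type*} [Field k] {G G' : Type*} [Group G] [Group G']
  {W T : Type*} [AddCommGroup W] [Module k W] [AddCommGroup T] [Module k T]

/-- **Pull-back preserves isotypy** (any homomorphism `f : G →* G'`, the pulled-back type irreducible): if the `k[G']`-module of `ρ'` is the
sum of its copies of `τ'`, then the `k[G]`-module of `ρ' ∘ f` is the sum of its copies of `τ' ∘ f`.  Each copy `m ≅ τ'` of `τ'` inside `W` is
the image of the `G'`-intertwiner `τ' ≅ m ↪ W`, which is also a `G`-intertwiner `τ' ∘ f → ρ' ∘ f`, so `m` lies in the `τ' ∘ f`-isotypic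
component (Mathlib `Submodule.map_le_isotypicComponent`); the copies span `W` (`Submodule.iSup_induction'`). [cite: Bump1997, §3.4 Prop. 3.4.1] -/
theorem isotypicComponent_comp_eq_top_of_isIrreducible (f : G →* G') (ρ' : Representation k G' W) (τ' : Representation k G' T)
    [hirr : Representation.IsIrreducible (V := T) ((τ' : G' →* (T →ₗ[k] T)).comp f)]
    (h : isotypicComponent (MonoidAlgebra k G') ρ'.asModule τ'.asModule = ⊤) :
    isotypicComponent (MonoidAlgebra k G) (Representation.asModule ((ρ' : G' →* (W →ₗ[k] W)).comp f))
      (Representation.asModule ((τ' : G' →* (T →ₗ[k] T)).comp f)) = ⊤ := by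
  classical
  -- work with an element of `ρ'.asModule` and read the goal membership through `id` (same underlying vector space `W`)
  suffices key : ∀ y : ρ'.asModule,
      (@id (Representation.asModule ((ρ' : G' →* (W →ₗ[k] W)).comp f)) y) ∈
        isotypicComponent (MonoidAlgebra k G) (Representation.asModule ((ρ' : G' →* (W →ₗ[k] W)).comp f))
          (Representation.asModule ((τ' : G' →* (T →ₗ[k] T)).comp f)) by
    rw [eq_top_iff]
    rintro x -
    exact key x
  intro y
  have hy : y ∈ ⨆ m : {m : Submodule (MonoidAlgebra k G') ρ'.asModule //
      Nonempty (m ≃ₗ[MonoidAlgebra k G'] τ'.asModule)}, (m : Submodule (MonoidAlgebra k G') ρ'.asModule) := by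
    have hy' : y ∈ isotypicComponent (MonoidAlgebra k G') ρ'.asModule τ'.asModule := by
      rw [h]; exact Submodule.mem_top
    rw [isotypicComponent, sSup_eq_iSup'] at hy'
    exact hy'
  induction hy using Submodule.iSup_induction' with
  | mem i z hz =>
    obtain ⟨m, ⟨em⟩⟩ := i
    change z ∈ m at hz
    -- the `k[G']`-linear map `τ' ≅ m ↪ W`, read as a `G'`-intertwiner `τ' → ρ'`
    let F' : τ'.asModule →ₗ[MonoidAlgebra k G'] ρ'.asModule := m.subtype ∘ₗ em.symm.toLinearMap
    let φ' : τ'.IntertwiningMap ρ' := (IntertwiningMap.equivLinearMapAsModule τ' ρ').symm F'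
    -- the same linear map intertwines the pulled-back representations of `G`
    let ψ : IntertwiningMap ((τ' : G' →* (T →ₗ[k] T)).comp f) ((ρ' : G' →* (W →ₗ[k] W)).comp f) :=
      φ'.toLinearMap.intertwiningMap_of_isIntertwiningMap _ _ fun g t => by
        change φ' (τ' (f g) t) = ρ' (f g) (φ' t)
        exact Representation.IntertwiningMap.isIntertwining τ' ρ' φ' (f g) t
    let F : Representation.asModule ((τ' : G' →* (T →ₗ[k] T)).comp f) →ₗ[MonoidAlgebra k G]
        Representation.asModule ((ρ' : G' →* (W →ₗ[k] W)).comp f) :=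
      IntertwiningMap.equivLinearMapAsModule _ _ ψ
    haveI : IsSimpleModule (MonoidAlgebra k G)
        (⊤ : Submodule (MonoidAlgebra k G) (Representation.asModule ((τ' : G' →* (T →ₗ[k] T)).comp f))) :=
      IsSimpleModule.congr Submodule.topEquiv
    have hle : Submodule.map F ⊤ ≤ isotypicComponent (MonoidAlgebra k G)
        (Representation.asModule ((ρ' : G' →* (W →ₗ[k] W)).comp f))
        (Representation.asModule ((τ' : G' →* (T →ₗ[k] T)).comp f)) :=
      (Submodule.map_le_isotypicComponent ⊤ F).trans_eq Submodule.topEquiv.isotypicComponent_eq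
    have hmem := hle ⟨em ⟨z, hz⟩, Submodule.mem_top, rfl⟩
    have hzF : F (em ⟨z, hz⟩) = @id (Representation.asModule ((ρ' : G' →* (W →ₗ[k] W)).comp f)) z := by
      change ((em.symm (em ⟨z, hz⟩) : m) : ρ'.asModule) = z
      rw [LinearEquiv.symm_apply_apply]
    exact hzF ▸ hmem
  | zero => exact Submodule.zero_mem _
  | add a b ha hb iha ihb => exact Submodule.add_mem _ iha ihb

/-- **Push-forward along a SURJECTIVE homomorphism**: if the `k[G]`-module of `ρ' ∘ f` is the sum of its copies of `τ' ∘ f` and `f` is onto,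
then the `k[G']`-module of `ρ'` is the sum of its copies of `τ'` (a `G`-intertwiner of the pull-backs is a `G'`-intertwiner).
[cite: Bump1997, §3.4 Prop. 3.4.1] -/
theorem isotypicComponent_eq_top_of_comp_eq_top (f : G →* G') (hf : Function.Surjective f) (ρ' : Representation k G' W)
    (τ' : Representation k G' T) [hirr : τ'.IsIrreducible]
    (h : isotypicComponent (MonoidAlgebra k G) (Representation.asModule ((ρ' : G' →* (W →ₗ[k] W)).comp f))
      (Representation.asModule ((τ' : G' →* (T →ₗ[k] T)).comp f)) = ⊤) :
    isotypicComponent (MonoidAlgebra k G') ρ'.asModule τ'.asModule = ⊤ := by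
  classical
  suffices key : ∀ y : Representation.asModule ((ρ' : G' →* (W →ₗ[k] W)).comp f),
      (@id ρ'.asModule y) ∈ isotypicComponent (MonoidAlgebra k G') ρ'.asModule τ'.asModule by
    rw [eq_top_iff]
    rintro x -
    exact key x
  intro y
  have hy : y ∈ ⨆ m : {m : Submodule (MonoidAlgebra k G) (Representation.asModule ((ρ' : G' →* (W →ₗ[k] W)).comp f)) //
      Nonempty (m ≃ₗ[MonoidAlgebra k G] Representation.asModule ((τ' : G' →* (T →ₗ[k] T)).comp f))},
      (m : Submodule (MonoidAlgebra k G) (Representation.asModule ((ρ' : G' →* (W →ₗ[k] W)).comp f))) := by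
    have hy' : y ∈ isotypicComponent (MonoidAlgebra k G) (Representation.asModule ((ρ' : G' →* (W →ₗ[k] W)).comp f))
        (Representation.asModule ((τ' : G' →* (T →ₗ[k] T)).comp f)) := by
      rw [h]; exact Submodule.mem_top
    rw [isotypicComponent, sSup_eq_iSup'] at hy'
    exact hy'
  induction hy using Submodule.iSup_induction' with
  | mem i z hz =>
    obtain ⟨m, ⟨em⟩⟩ := i
    change z ∈ m at hz
    let F : Representation.asModule ((τ' : G' →* (T →ₗ[k] T)).comp f) →ₗ[MonoidAlgebra k G]
        Representation.asModule ((ρ' : G' →* (W →ₗ[k] W)).comp f) := m.subtype ∘ₗ em.symm.toLinearMap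
    let ψ : IntertwiningMap ((τ' : G' →* (T →ₗ[k] T)).comp f) ((ρ' : G' →* (W →ₗ[k] W)).comp f) :=
      (IntertwiningMap.equivLinearMapAsModule _ _).symm F
    -- a `G`-intertwiner of the pull-backs is a `G'`-intertwiner (`f` onto)
    let φ' : τ'.IntertwiningMap ρ' :=
      ψ.toLinearMap.intertwiningMap_of_isIntertwiningMap τ' ρ' fun g' t => by
        obtain ⟨g, rfl⟩ := hf g'
        change ψ (((τ' : G' →* (T →ₗ[k] T)).comp f) g t) = ((ρ' : G' →* (W →ₗ[k] W)).comp f) g (ψ t)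
        exact Representation.IntertwiningMap.isIntertwining _ _ ψ g t
    let F' : τ'.asModule →ₗ[MonoidAlgebra k G'] ρ'.asModule := IntertwiningMap.equivLinearMapAsModule τ' ρ' φ'
    haveI : IsSimpleModule (MonoidAlgebra k G') (⊤ : Submodule (MonoidAlgebra k G') τ'.asModule) :=
      IsSimpleModule.congr Submodule.topEquiv
    have hle : Submodule.map F' ⊤ ≤ isotypicComponent (MonoidAlgebra k G') ρ'.asModule τ'.asModule :=
      (Submodule.map_le_isotypicComponent ⊤ F').trans_eq Submodule.topEquiv.isotypicComponent_eq
    have hmem := hle ⟨em ⟨z, hz⟩, Submodule.mem_top, rfl⟩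
    have hzF : F' (em ⟨z, hz⟩) = @id ρ'.asModule z := by
      change ((em.symm (em ⟨z, hz⟩) : m) : Representation.asModule ((ρ' : G' →* (W →ₗ[k] W)).comp f)) = z
      rw [LinearEquiv.symm_apply_apply]
    exact hzF ▸ hmem
  | zero => exact Submodule.zero_mem _
  | add a b ha hb iha ihb => exact Submodule.add_mem _ iha ihb

/-- **Isotypy is invariant under pull-back along a surjection**: for `f : G →* G'` onto and `τ'` irreducible, `ρ' ∘ f` is `τ' ∘ f`-isotypic iff
`ρ'` is `τ'`-isotypic (irreducibility of `τ' ∘ f`: ★ `Representation.isIrreducible_comp_iff_of_surjective`). [cite: Bump1997, §3.4 Prop. 3.4.1] -/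
theorem isotypicComponent_comp_eq_top_iff_of_surjective (f : G →* G') (hf : Function.Surjective f) (ρ' : Representation k G' W)
    (τ' : Representation k G' T) [hirr : τ'.IsIrreducible] :
    isotypicComponent (MonoidAlgebra k G) (Representation.asModule ((ρ' : G' →* (W →ₗ[k] W)).comp f))
        (Representation.asModule ((τ' : G' →* (T →ₗ[k] T)).comp f)) = ⊤ ↔
      isotypicComponent (MonoidAlgebra k G') ρ'.asModule τ'.asModule = ⊤ := by
  haveI : Representation.IsIrreducible (V := T) ((τ' : G' →* (T →ₗ[k] T)).comp f) :=
    (Representation.isIrreducible_comp_iff_of_surjective τ' f hf).2 hirr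
  exact ⟨isotypicComponent_eq_top_of_comp_eq_top f hf ρ' τ', isotypicComponent_comp_eq_top_of_isIrreducible f ρ' τ'⟩

/-- **Isotypy along a group isomorphism** `e : G ≃* G'`: `ρ' ∘ e` is `τ' ∘ e`-isotypic iff `ρ'` is `τ'`-isotypic (`τ'` irreducible) — the
local type of a representation of `U(J)(F_v)` read on `U(J')(F_v)` along `u ↦ B u B⁻¹`. [cite: Bump1997, §3.4 Prop. 3.4.1]
[cite: PlatonovRapinchuk1994, §2.3] -/
theorem isotypicComponent_comp_mulEquiv_eq_top_iff (e : G ≃* G') (ρ' : Representation k G' W) (τ' : Representation k G' T)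
    [hirr : τ'.IsIrreducible] :
    isotypicComponent (MonoidAlgebra k G) (Representation.asModule ((ρ' : G' →* (W →ₗ[k] W)).comp e.toMonoidHom))
        (Representation.asModule ((τ' : G' →* (T →ₗ[k] T)).comp e.toMonoidHom)) = ⊤ ↔
      isotypicComponent (MonoidAlgebra k G') ρ'.asModule τ'.asModule = ⊤ :=
  isotypicComponent_comp_eq_top_iff_of_surjective e.toMonoidHom e.surjective ρ' τ'

end Literature.RepresentationTheory
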